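import Mathlib
import Summits.AtomisticToContinuum.HydrodynamicLimit.Theorems.ImplosionDichotomyDenseExcursionCavityNegExpFuchs
import Summits.AtomisticToContinuum.HydrodynamicLimit.Theorems.ImplosionDichotomyDenseExcursionCavityResVolterra

/-!
# The smooth branch of a first-kind singular system at a jet resonance `ν = m ∈ ℕ`, by descent from `ν = −1`
# (crux `DenseExcursion`, line `sonic-cavity-renewal`, bricks for stub `stub_cavityResolventCk`, theorem T6 at the
# jet resonances)

Helper file (`--supports stmt-AtomisticToContinuum-12586`, line lead a2, stub-worker E2 for `stub_cavityResolventCk`).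
For a complex Banach space `E` consider the first-kind singular system with a VECTOR-VALUED REGULAR ROW

  `R·u′ = a₁₁ u + a₁₂(c) + b₁`,   `c′ = a₂₁(u) + a₂₂(c) + b₂`   (`u : ℝ → ℂ`, `c : ℝ → E`)

with smooth coefficient fields `a₁₁ : ℝ → ℂ`, `a₁₂ : ℝ → (E →L[ℂ] ℂ)`, `a₂₁ : ℝ → (ℂ →L[ℂ] E)`, `a₂₂ : ℝ → (E →L[ℂ] E)`.

* `res_fuchs_branch` (registered) — EXPONENT `Re a₁₁(0) ≤ −1`: for all smooth sources and every `c₀ : E` a `C^∞` solution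
  on a fixed `(−δ, δ)` with `c(0) = c₀`; verbatim the scalar `fuchs_branch_of_re_le_neg_one` (Hadamard, integrating factor,
  complex-weight Euler operator, Volterra row by `res_volterra_fixed_point`, bootstrap `c ∈ C^k ⇒ u ∈ C^k ⇒ c ∈ C^{k+1}`).
* `res_branch_nat` (registered) — JET RESONANCE `a₁₁(0) = n ∈ ℕ` (the formal recursion for the Taylor coefficients of `u`
  degenerates at order `n`): ONE DIFFERENTIATION of the singular row lowers the exponent by one — with `U = u′` and the
  enlarged regular unknown `(u, c) ∈ ℂ × E`,
  `R·U′ = (a₁₁ − 1)U + [a₁₁′ u + a₁₂(a₂₁ u + a₂₂ c) + a₁₂′ c] + (a₁₂ b₂ + b₁′)`, `(u, c)′ = (U, a₂₁ u + a₂₂ c + b₂)`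
  is a system of the same type over `ℂ × E` with exponent `n − 1` (`derived_coefficients`), and a solution of the derived
  system descends to one of the original system iff the single scalar constraint `a₁₁(0)u(0) + a₁₂(0)c(0) + b₁(0) = 0`
  holds (`descend_row`: the residual of the singular row has zero derivative; `lift_solution`). Iterating down to exponent
  `−1` and solving the triangular constraints (coefficient `ν − j ≠ 0` at the levels `j ≠ n`, degenerate at level `n`):
  there are `δ > 0` and `ℓ : E →L[ℂ] ℂ` such that for all smooth sources there is `β ∈ ℂ` (`β = 0` for zero sources)
  with: for every `c₀` with `ℓ c₀ + β = 0` and every `t : ℂ` a `C^∞` solution on `(−δ, δ)` with `c(0) = c₀`, `u⁽ⁿ⁾(0) = t`.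
* `fuchs_branch_resonant` (registered) — the scalar form (`E = ℂ`, scalar coefficients, `ℓ ∈ ℂ`): the COMPATIBILITY
  COEFFICIENT `ℓ` decides between "particular solutions for every source, one free resonant coefficient" (`ℓ ≠ 0`) and
  "two-dimensional smooth homogeneous branch" (`ℓ = 0`) — the local theory of the cavity resolvent at the four genuine
  jet resonances `ν(Λ) ∈ {0, 1, 2, 3}` of the repulsive sonic point (`…CavityResonance`).

Also small tools on the `ℝ`-calculus of `ℂ`-linear operator fields (`contDiffOn_clm_apply_real`, `contDiff_clm_apply_real`,
`contDiff_clm_comp_real`, `hasDerivAt_clm_apply_real`). Sources: folklore (Coddington–Levinson 1955 Ch. 4 §2, §8; here in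
the `C^∞` category by reduction to the non-resonant Volterra construction).
-/

noncomputable section

open Set Filter MeasureTheory intervalIntegral
open scoped Topology ContDiff

namespace Summit.AtomisticToContinuum.HydrodynamicLimit.Theorems.SonicCavityRenewal

/-! ## Evaluating a `ℂ`-linear operator field along an `ℝ`-smooth curve -/

/-- `x ↦ f(x)(g(x))` is `C^n` over `ℝ` on `s` if the `ℂ`-linear operator field `f` and the vector field `g` are
(evaluation is a bounded bilinear map over `ℂ`, hence smooth over `ℝ`). [folklore] -/
theorem contDiffOn_clm_apply_real {E F : Type*} [NormedAddCommGroup E] [NormedSpace ℂ E] [NormedAddCommGroup F]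
    [NormedSpace ℂ F] {n : WithTop ℕ∞} {f : ℝ → E →L[ℂ] F} {g : ℝ → E} {s : Set ℝ} (hf : ContDiffOn ℝ n f s)
    (hg : ContDiffOn ℝ n g s) : ContDiffOn ℝ n (fun x => f x (g x)) s := by
  have key : ContDiff ℝ n (fun p : (E →L[ℂ] F) × E => p.1 p.2) :=
    ((isBoundedBilinearMap_apply (𝕜 := ℂ) (E := E) (F := F)).contDiff).restrict_scalars ℝ
  exact key.comp_contDiffOn (hf.prodMk hg)

/-- Global version of `contDiffOn_clm_apply_real`. [folklore] -/
theorem contDiff_clm_apply_real {E F : Type*} [NormedAddCommGroup E] [NormedSpace ℂ E] [NormedAddCommGroup F]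
    [NormedSpace ℂ F] {n : WithTop ℕ∞} {f : ℝ → E →L[ℂ] F} {g : ℝ → E} (hf : ContDiff ℝ n f) (hg : ContDiff ℝ n g) :
    ContDiff ℝ n (fun x => f x (g x)) := by
  rw [← contDiffOn_univ] at hf hg ⊢
  exact contDiffOn_clm_apply_real hf hg

/-! ## The smooth branch for `Re ν ≤ −1` with a vector-valued regular row -/

/-- **Registered helper `res_fuchs_branch`: THE SMOOTH BRANCH OF A FIRST-KIND SINGULAR SYSTEM WITH A VECTOR-VALUED
REGULAR ROW AND EXPONENT `Re ν ≤ −1`.** See the module docstring. [folklore] -/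
theorem res_fuchs_branch : ∀ (E : Type) [NormedAddCommGroup E] [NormedSpace ℂ E] [CompleteSpace E] (ν : ℂ) (a₁₁ : ℝ → ℂ) (a₁₂ : ℝ → E →L[ℂ] ℂ) (a₂₁ : ℝ → ℂ →L[ℂ] E) (a₂₂ : ℝ → E →L[ℂ] E), ν.re ≤ -1 → ContDiff ℝ ∞ a₁₁ → ContDiff ℝ ∞ a₁₂ → ContDiff ℝ ∞ a₂₁ → ContDiff ℝ ∞ a₂₂ → a₁₁ 0 = ν → ∃ δ : ℝ, 0 < δ ∧ ∀ (b₁ : ℝ → ℂ) (b₂ : ℝ → E), ContDiff ℝ ∞ b₁ → ContDiff ℝ ∞ b₂ → ∀ c₀ : E, ∃ (u : ℝ → ℂ) (c : ℝ → E), ContDiffOn ℝ ∞ u (Set.Ioo (-δ) δ) ∧ ContDiffOn ℝ ∞ c (Set.Ioo (-δ) δ) ∧ c 0 = c₀ ∧ ∀ R ∈ Set.Ioo (-δ) δ, (R : ℂ) * deriv u R = a₁₁ R * u R + a₁₂ R (c R) + b₁ R ∧ deriv c R = a₂₁ R (u R) + a₂₂ R (c R) + b₂ R := by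
  intro E _ _ _ ν a₁₁ a₁₂ a₂₁ a₂₂ hν ha₁₁ ha₁₂ ha₂₁ ha₂₂ h0
  -- the vector field of the `u`-coupling in the regular row: `a₂₁(R)(u) = u • a₂₁(R)(1)`
  have ha₂₁' : ContDiff ℝ ∞ (fun s => a₂₁ s 1) := contDiff_clm_apply_real ha₂₁ contDiff_const
  have hsm : ∀ (s : ℝ) (z : ℂ), a₂₁ s z = z • a₂₁ s 1 := fun s z => by simpa using (a₂₁ s).map_smul z 1
  -- the weight exponent
  set a : ℂ := -ν - 1 with ha_def
  have ha : 0 ≤ a.re := by simp only [ha_def, Complex.sub_re, Complex.neg_re, Complex.one_re]; linarith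
  -- Hadamard: `a₁₁ − ν = R·α`
  obtain ⟨α, hα, hαeq, -⟩ := hadamard_quotient (φ := fun R => a₁₁ R - ν) (ha₁₁.sub contDiff_const) (by simp [h0])
  -- the integrating factor `μ = exp ∫₀ᴿ α`
  obtain ⟨hPsm, hPd⟩ := contDiff_primitive hα
  set μ : ℝ → ℂ := fun R => Complex.exp (∫ s in (0 : ℝ)..R, α s) with hμ
  have hμsm : ContDiff ℝ ∞ μ := Complex.contDiff_exp.comp hPsm
  have hμ0 : ∀ R, μ R ≠ 0 := fun R => Complex.exp_ne_zero _
  have hμd : ∀ R, HasDerivAt μ (α R * μ R) R := fun R => by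
    have := (hPd R).cexp
    simpa [hμ, mul_comm] using this
  -- the Volterra fixed point
  obtain ⟨δ, hδ, hfix⟩ := res_volterra_fixed_point E a μ a₁₂ (fun s => a₂₁ s 1) a₂₂ ha hμsm.continuous hμ0
    ha₁₂.continuous ha₂₁'.continuous ha₂₂.continuous
  refine ⟨δ, hδ, fun b₁ b₂ hb₁ hb₂ c₀ => ?_⟩
  obtain ⟨u, c, hu_cont, hc_cont, hu, hc⟩ := hfix b₁ b₂ hb₁.continuous hb₂.continuous c₀
  have hU : IsOpen (Ioo (-δ) δ) := isOpen_Ioo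
  -- the source of the Euler row and the integrand of the primitive
  set h : ℝ → ℂ := fun s => (a₁₂ s (c s) + b₁ s) / μ s with hh
  set Y : ℝ → ℂ := fun R => ∫ t in (0 : ℝ)..1, (t : ℂ) ^ a * h (R * t) with hY
  set K : ℝ → E := fun s => a₂₁ s (u s) + a₂₂ s (c s) + b₂ s with hK
  have huY : u = fun R => μ R * Y R := funext fun R => by rw [hu R]
  have hKeq : (fun s => u s • a₂₁ s 1 + a₂₂ s (c s) + b₂ s) = K := funext fun s => by simp only [hK, hsm s (u s)]
  have hKc : Continuous K :=
    ((ha₂₁.continuous.clm_apply hu_cont).add (ha₂₂.continuous.clm_apply hc_cont)).add hb₂.continuous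
  -- the derivative of `c` on `(−δ, δ)`
  have hcd : ∀ R ∈ Ioo (-δ) δ, HasDerivAt c (K R) R := by
    intro R hR
    have hprim : HasDerivAt (fun R => c₀ + ∫ s in (0 : ℝ)..R, K s) (K R) R := by
      have := integral_hasDerivAt_right (hKc.intervalIntegrable 0 R) hKc.aestronglyMeasurable.stronglyMeasurableAtFilter
        hKc.continuousAt
      simpa using this.const_add c₀
    refine hprim.congr_of_eventuallyEq ?_
    filter_upwards [hU.mem_nhds hR] with s hs
    rw [hc s (Ioo_subset_Icc_self hs), hKeq]
  -- bootstrap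
  have hle : ∀ {n : ℕ∞}, ((n : ℕ∞) : WithTop ℕ∞) ≤ ∞ := fun {n} => by exact_mod_cast le_top
  have hhdef : h = fun s => (μ s)⁻¹ * (a₁₂ s (c s) + b₁ s) := funext fun s => by rw [hh]; simp only; rw [div_eq_inv_mul]
  have hboot : ∀ k : ℕ, ContDiffOn ℝ k c (Ioo (-δ) δ) ∧ ContDiffOn ℝ k u (Ioo (-δ) δ) := by
    have step_u : ∀ {n : ℕ∞}, ContDiffOn ℝ n c (Ioo (-δ) δ) → ContDiffOn ℝ n u (Ioo (-δ) δ) := by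
      intro n hcn
      have hhn : ContDiffOn ℝ n h (Ioo (-δ) δ) := by
        rw [hhdef]
        exact ((hμsm.of_le hle).contDiffOn.inv fun s _ => hμ0 s).mul
          ((contDiffOn_clm_apply_real (ha₁₂.of_le hle).contDiffOn hcn).add (hb₁.of_le hle).contDiffOn)
      rw [huY]
      exact (hμsm.of_le hle).contDiffOn.mul (contDiffOn_eulerCpow_local ha hhn)
    intro k
    induction k with
    | zero =>
      have hc0 : ContDiffOn ℝ 0 c (Ioo (-δ) δ) := contDiffOn_zero.2 hc_cont.continuousOn
      exact ⟨by exact_mod_cast hc0, by exact_mod_cast step_u hc0⟩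
    | succ k ih =>
      obtain ⟨ihc, ihu⟩ := ih
      have hKk : ContDiffOn ℝ k K (Ioo (-δ) δ) :=
        ((contDiffOn_clm_apply_real (ha₂₁.of_le hle).contDiffOn ihu).add
          (contDiffOn_clm_apply_real (ha₂₂.of_le hle).contDiffOn ihc)).add (hb₂.of_le hle).contDiffOn
      have hck : ContDiffOn ℝ ((k + 1 : ℕ) : WithTop ℕ∞) c (Ioo (-δ) δ) := by
        rw [Nat.cast_succ, contDiffOn_succ_iff_deriv_of_isOpen hU]
        refine ⟨fun R hR => (hcd R hR).differentiableAt.differentiableWithinAt,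
          fun h => (WithTop.natCast_ne_top k h).elim, ?_⟩
        exact hKk.congr fun R hR => (hcd R hR).deriv
      have hck' : ContDiffOn ℝ ((k + 1 : ℕ) : ℕ∞) c (Ioo (-δ) δ) := by exact_mod_cast hck
      exact ⟨by exact_mod_cast hck', by exact_mod_cast step_u hck'⟩
  have hcs : ContDiffOn ℝ ∞ c (Ioo (-δ) δ) := contDiffOn_infty.2 fun k => (hboot k).1
  have hus : ContDiffOn ℝ ∞ u (Ioo (-δ) δ) := contDiffOn_infty.2 fun k => (hboot k).2
  have hhs : ContDiffOn ℝ ∞ h (Ioo (-δ) δ) := by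
    rw [hhdef]
    exact (hμsm.contDiffOn.inv fun s _ => hμ0 s).mul
      ((contDiffOn_clm_apply_real ha₁₂.contDiffOn hcs).add hb₁.contDiffOn)
  -- the Euler row
  obtain ⟨hYs, hYode, -⟩ := eulerCpow_local a δ h ha hδ hhs
  refine ⟨u, c, hus, hcs, by have := hc 0 ⟨by linarith, by linarith⟩; simpa using this, fun R hR => ⟨?_, (hcd R hR).deriv⟩⟩
  have hYd : HasDerivAt Y (deriv Y R) R :=
    ((hYs.differentiableOn (by simp)) R hR).differentiableAt (hU.mem_nhds hR) |>.hasDerivAt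
  have hud : HasDerivAt u (α R * μ R * Y R + μ R * deriv Y R) R := by
    rw [huY]; exact (hμd R).mul hYd
  rw [hud.deriv]
  have e1 := hYode R hR
  have e1' : (R : ℂ) * deriv Y R = ν * Y R + h R := by
    have : -(a + 1) = ν := by rw [ha_def]; ring
    rw [← this]; exact e1
  have e2 : (R : ℂ) * α R = a₁₁ R - ν := by simpa using (hαeq R).symm
  have e3 : μ R * h R = a₁₂ R (c R) + b₁ R := by
    simp only [hh]; field_simp [hμ0 R]
  have e4 : u R = μ R * Y R := by rw [huY]
  rw [e4]
  linear_combination (μ R * Y R) * e2 + μ R * e1' + e3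


/-! ## `ℝ`-calculus of `ℂ`-linear operator fields -/

/-- `x ↦ f(x) ∘ g(x)` is `C^n` over `ℝ` if the `ℂ`-linear operator fields `f`, `g` are (composition is a bounded bilinear
map over `ℂ`). [folklore] -/
theorem contDiff_clm_comp_real {E F G : Type*} [NormedAddCommGroup E] [NormedSpace ℂ E] [NormedAddCommGroup F]
    [NormedSpace ℂ F] [NormedAddCommGroup G] [NormedSpace ℂ G] {n : WithTop ℕ∞} {f : ℝ → F →L[ℂ] G}
    {g : ℝ → E →L[ℂ] F} (hf : ContDiff ℝ n f) (hg : ContDiff ℝ n g) : ContDiff ℝ n (fun x => (f x).comp (g x)) := by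
  have key : ContDiff ℝ n (fun p : (F →L[ℂ] G) × (E →L[ℂ] F) => p.1.comp p.2) :=
    ((isBoundedBilinearMap_comp (𝕜 := ℂ) (E := E) (F := F) (G := G)).contDiff).restrict_scalars ℝ
  exact key.comp (hf.prodMk hg)

/-- The derivative of `x ↦ f(x)(g(x))` for a `ℂ`-linear operator field `f` and a vector field `g`, both differentiable
over `ℝ`: `f(x)(g′) + f′(g(x))`. [folklore] -/
theorem hasDerivAt_clm_apply_real {E F : Type*} [NormedAddCommGroup E] [NormedSpace ℂ E] [NormedAddCommGroup F]
    [NormedSpace ℂ F] {f : ℝ → E →L[ℂ] F} {g : ℝ → E} {f' : E →L[ℂ] F} {g' : E} {x : ℝ} (hf : HasDerivAt f f' x)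
    (hg : HasDerivAt g g' x) : HasDerivAt (fun y => f y (g y)) (f x g' + f' (g x)) x := by
  have hB := (isBoundedBilinearMap_apply (𝕜 := ℂ) (E := E) (F := F)).hasFDerivAt (f x, g x)
  have h2 := (hB.restrictScalars ℝ).comp_hasDerivAt x (hf.prodMk hg)
  simpa [Function.comp_def, IsBoundedBilinearMap.deriv_apply] using h2

/-! ## The derived system and the descent of solutions -/

/-- **THE DERIVED COEFFICIENTS.** The coupling `(u, c) ↦ a₁₁′ u + a₁₂(a₂₁ u + a₂₂ c) + a₁₂′ c` of the differentiated
singular row and the regular operator `(u, c) ↦ (0, a₂₁ u + a₂₂ c)` of the enlarged regular row are smooth `ℂ`-linear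
operator fields on `ℂ × E`. [folklore] -/
theorem derived_coefficients {E : Type*} [NormedAddCommGroup E] [NormedSpace ℂ E] {a₁₁ : ℝ → ℂ}
    {a₁₂ : ℝ → E →L[ℂ] ℂ} {a₂₁ : ℝ → ℂ →L[ℂ] E} {a₂₂ : ℝ → E →L[ℂ] E} (ha₁₁ : ContDiff ℝ ∞ a₁₁)
    (ha₁₂ : ContDiff ℝ ∞ a₁₂) (ha₂₁ : ContDiff ℝ ∞ a₂₁) (ha₂₂ : ContDiff ℝ ∞ a₂₂) :
    ∃ (A₁₂ : ℝ → (ℂ × E) →L[ℂ] ℂ) (A₂₂ : ℝ → (ℂ × E) →L[ℂ] (ℂ × E)), ContDiff ℝ ∞ A₁₂ ∧ ContDiff ℝ ∞ A₂₂ ∧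
      (∀ (R : ℝ) (w : ℂ × E), A₁₂ R w = deriv a₁₁ R * w.1 + a₁₂ R (a₂₁ R w.1 + a₂₂ R w.2) + deriv a₁₂ R w.2) ∧
      (∀ (R : ℝ) (w : ℂ × E), A₂₂ R w = (0, a₂₁ R w.1 + a₂₂ R w.2)) := by
  have ha₁₁' : ContDiff ℝ ∞ (deriv a₁₁) := (contDiff_infty_iff_deriv.1 ha₁₁).2
  have ha₁₂' : ContDiff ℝ ∞ (deriv a₁₂) := (contDiff_infty_iff_deriv.1 ha₁₂).2
  -- the inner operator `(u, c) ↦ a₂₁ u + a₂₂ c`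
  set J : ℝ → (ℂ × E) →L[ℂ] E := fun R =>
    (a₂₁ R).comp (ContinuousLinearMap.fst ℂ ℂ E) + (a₂₂ R).comp (ContinuousLinearMap.snd ℂ ℂ E) with hJ
  have hJs : ContDiff ℝ ∞ J := (contDiff_clm_comp_real ha₂₁ contDiff_const).add (contDiff_clm_comp_real ha₂₂ contDiff_const)
  have hJap : ∀ (R : ℝ) (w : ℂ × E), J R w = a₂₁ R w.1 + a₂₂ R w.2 := fun R w => by simp [hJ]
  refine ⟨fun R => deriv a₁₁ R • ContinuousLinearMap.fst ℂ ℂ E + (a₁₂ R).comp (J R) +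
      (deriv a₁₂ R).comp (ContinuousLinearMap.snd ℂ ℂ E),
    fun R => (ContinuousLinearMap.inr ℂ ℂ E).comp (J R), ?_, ?_, fun R w => ?_, fun R w => ?_⟩
  · exact ((ha₁₁'.smul contDiff_const).add (contDiff_clm_comp_real ha₁₂ hJs)).add
      (contDiff_clm_comp_real ha₁₂' contDiff_const)
  · exact contDiff_clm_comp_real contDiff_const hJs
  · simp [hJap]
  · simp [hJap]

/-- **DESCENT OF THE SINGULAR ROW.** If `u′ = U` on `(−δ, δ)`, `U` satisfies the differentiated singular row
`R·U′ = (a₁₁ − 1)U + a₁₁′u + a₁₂(c′) + a₁₂′(c) + b₁′` there, and the constraint `a₁₁(0)u(0) + a₁₂(0)c(0) + b₁(0) = 0`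
holds, then `u` satisfies the singular row `R·u′ = a₁₁u + a₁₂(c) + b₁` on `(−δ, δ)` (the residual has zero derivative and
vanishes at `0`). [folklore] -/
theorem descend_row {E : Type*} [NormedAddCommGroup E] [NormedSpace ℂ E] {a₁₁ b₁ U u : ℝ → ℂ} {a₁₂ : ℝ → E →L[ℂ] ℂ}
    {c : ℝ → E} {δ : ℝ} (ha₁₁ : ContDiff ℝ ∞ a₁₁) (ha₁₂ : ContDiff ℝ ∞ a₁₂) (hb₁ : ContDiff ℝ ∞ b₁) (hδ : 0 < δ)
    (hU : ContDiffOn ℝ ∞ U (Ioo (-δ) δ)) (hu : ContDiffOn ℝ ∞ u (Ioo (-δ) δ)) (hc : ContDiffOn ℝ ∞ c (Ioo (-δ) δ))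
    (hu' : ∀ R ∈ Ioo (-δ) δ, deriv u R = U R)
    (hrow : ∀ R ∈ Ioo (-δ) δ, (R : ℂ) * deriv U R =
      (a₁₁ R - 1) * U R + (deriv a₁₁ R * u R + a₁₂ R (deriv c R) + deriv a₁₂ R (c R)) + deriv b₁ R)
    (h0 : a₁₁ 0 * u 0 + a₁₂ 0 (c 0) + b₁ 0 = 0) :
    ∀ R ∈ Ioo (-δ) δ, (R : ℂ) * deriv u R = a₁₁ R * u R + a₁₂ R (c R) + b₁ R := by
  have hO : IsOpen (Ioo (-δ) δ) := isOpen_Ioo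
  have h0U : (0 : ℝ) ∈ Ioo (-δ) δ := ⟨by linarith, hδ⟩
  have hdf : ∀ {φ : ℝ → ℂ}, ContDiffOn ℝ ∞ φ (Ioo (-δ) δ) → ∀ y ∈ Ioo (-δ) δ, HasDerivAt φ (deriv φ y) y :=
    fun hφ y hy => ((hφ.differentiableOn (by simp)) y hy |>.differentiableAt (hO.mem_nhds hy)).hasDerivAt
  have hdfE : ∀ {φ : ℝ → E}, ContDiffOn ℝ ∞ φ (Ioo (-δ) δ) → ∀ y ∈ Ioo (-δ) δ, HasDerivAt φ (deriv φ y) y :=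
    fun hφ y hy => ((hφ.differentiableOn (by simp)) y hy |>.differentiableAt (hO.mem_nhds hy)).hasDerivAt
  have hdg : ∀ {φ : ℝ → ℂ}, ContDiff ℝ ∞ φ → ∀ y, HasDerivAt φ (deriv φ y) y :=
    fun hφ y => (hφ.differentiable (by simp) y).hasDerivAt
  have hdgL : ∀ {φ : ℝ → E →L[ℂ] ℂ}, ContDiff ℝ ∞ φ → ∀ y, HasDerivAt φ (deriv φ y) y :=
    fun hφ y => (hφ.differentiable (by simp) y).hasDerivAt
  -- the residual and its vanishing derivative
  set ρ : ℝ → ℂ := fun R => (R : ℂ) * U R - a₁₁ R * u R - a₁₂ R (c R) - b₁ R with hρ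
  have hρd : ∀ R ∈ Ioo (-δ) δ, HasDerivAt ρ 0 R := by
    intro R hR
    have d1 : HasDerivAt (fun R : ℝ => (R : ℂ) * U R) (1 * U R + (R : ℂ) * deriv U R) R := by
      have h := (hasDerivAt_id R).ofReal_comp
      simp only [id, Complex.ofReal_one] at h
      exact h.mul (hdf hU R hR)
    have d2 : HasDerivAt (fun R => a₁₁ R * u R) (deriv a₁₁ R * u R + a₁₁ R * U R) R := by
      have := (hdg ha₁₁ R).mul (hdf hu R hR)
      rwa [hu' R hR] at this
    have d3 : HasDerivAt (fun R => a₁₂ R (c R)) (a₁₂ R (deriv c R) + deriv a₁₂ R (c R)) R :=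
      hasDerivAt_clm_apply_real (hdgL ha₁₂ R) (hdfE hc R hR)
    have d4 : HasDerivAt b₁ (deriv b₁ R) R := hdg hb₁ R
    refine (((d1.sub d2).sub d3).sub d4).congr_deriv ?_
    linear_combination hrow R hR
  -- hence the residual is constant, equal to its value `0` at `R = 0`
  intro R hR
  have hsub : uIcc 0 R ⊆ Ioo (-δ) δ := by
    intro y hy
    rcases mem_uIcc.1 hy with h | h
    · exact ⟨by linarith [h.1], lt_of_le_of_lt h.2 hR.2⟩
    · exact ⟨lt_of_lt_of_le hR.1 h.1, by linarith [h.2, hδ]⟩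
  have key := Convex.norm_image_sub_le_of_norm_hasDerivWithin_le (f := ρ) (f' := fun _ => 0) (C := 0)
    (fun y hy => (hρd y (hsub hy)).hasDerivWithinAt) (fun y _ => by simp) (convex_uIcc 0 R) left_mem_uIcc right_mem_uIcc
  rw [zero_mul, norm_le_zero_iff, sub_eq_zero] at key
  have hρ0 : ρ 0 = 0 := by simp only [hρ, Complex.ofReal_zero, zero_mul, zero_sub]; linear_combination -h0
  have hρR : ρ R = 0 := key.trans hρ0
  simp only [hρ] at hρR
  rw [hu' R hR]
  linear_combination hρR

/-- **LIFTING A SOLUTION OF THE DERIVED SYSTEM.** A smooth solution `(U, v)`, `v = (u, c) : ℝ → ℂ × E`, of the derived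
system on `(−δ, δ)` whose datum satisfies the constraint `a₁₁(0)u(0) + a₁₂(0)c(0) + b₁(0) = 0` gives the smooth solution
`(u, c)` of the original system on `(−δ, δ)`, with `u′ = U` there. [folklore] -/
theorem lift_solution {E : Type*} [NormedAddCommGroup E] [NormedSpace ℂ E] {a₁₁ b₁ U : ℝ → ℂ} {a₁₂ : ℝ → E →L[ℂ] ℂ}
    {a₂₁ : ℝ → ℂ →L[ℂ] E} {a₂₂ : ℝ → E →L[ℂ] E} {b₂ : ℝ → E} {A₁₂ : ℝ → (ℂ × E) →L[ℂ] ℂ}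
    {A₂₂ : ℝ → (ℂ × E) →L[ℂ] (ℂ × E)} {v : ℝ → ℂ × E} {δ : ℝ} (ha₁₁ : ContDiff ℝ ∞ a₁₁) (ha₁₂ : ContDiff ℝ ∞ a₁₂)
    (hb₁ : ContDiff ℝ ∞ b₁) (hδ : 0 < δ)
    (hA₁₂ : ∀ (R : ℝ) (w : ℂ × E), A₁₂ R w = deriv a₁₁ R * w.1 + a₁₂ R (a₂₁ R w.1 + a₂₂ R w.2) + deriv a₁₂ R w.2)
    (hA₂₂ : ∀ (R : ℝ) (w : ℂ × E), A₂₂ R w = (0, a₂₁ R w.1 + a₂₂ R w.2))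
    (hU : ContDiffOn ℝ ∞ U (Ioo (-δ) δ)) (hv : ContDiffOn ℝ ∞ v (Ioo (-δ) δ))
    (hrowU : ∀ R ∈ Ioo (-δ) δ, (R : ℂ) * deriv U R = (a₁₁ R - 1) * U R + A₁₂ R (v R) + (a₁₂ R (b₂ R) + deriv b₁ R))
    (hrowv : ∀ R ∈ Ioo (-δ) δ, deriv v R = (ContinuousLinearMap.inl ℂ ℂ E) (U R) + A₂₂ R (v R) + ((0 : ℂ), b₂ R))
    (h0 : a₁₁ 0 * (v 0).1 + a₁₂ 0 (v 0).2 + b₁ 0 = 0) :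
    ContDiffOn ℝ ∞ (fun R => (v R).1) (Ioo (-δ) δ) ∧ ContDiffOn ℝ ∞ (fun R => (v R).2) (Ioo (-δ) δ) ∧
      (∀ R ∈ Ioo (-δ) δ, deriv (fun R => (v R).1) R = U R) ∧
      ∀ R ∈ Ioo (-δ) δ, (R : ℂ) * deriv (fun R => (v R).1) R = a₁₁ R * (v R).1 + a₁₂ R (v R).2 + b₁ R ∧
        deriv (fun R => (v R).2) R = a₂₁ R (v R).1 + a₂₂ R (v R).2 + b₂ R := by
  have hO : IsOpen (Ioo (-δ) δ) := isOpen_Ioo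
  have hu : ContDiffOn ℝ ∞ (fun R => (v R).1) (Ioo (-δ) δ) := hv.fst
  have hc : ContDiffOn ℝ ∞ (fun R => (v R).2) (Ioo (-δ) δ) := hv.snd
  -- the components of the regular row
  have hcomp : ∀ R ∈ Ioo (-δ) δ, deriv (fun R => (v R).1) R = U R ∧
      deriv (fun R => (v R).2) R = a₂₁ R (v R).1 + a₂₂ R (v R).2 + b₂ R := by
    intro R hR
    have hvd : HasDerivAt v (deriv v R) R :=
      ((hv.differentiableOn (by simp)) R hR |>.differentiableAt (hO.mem_nhds hR)).hasDerivAt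
    have h1 : HasDerivAt (fun x => (v x).1) (deriv v R).1 R := by simpa using hvd.hasFDerivAt.fst.hasDerivAt
    have h2 : HasDerivAt (fun x => (v x).2) (deriv v R).2 R := by simpa using hvd.hasFDerivAt.snd.hasDerivAt
    rw [h1.deriv, h2.deriv, hrowv R hR, hA₂₂]
    simp
  have hu' : ∀ R ∈ Ioo (-δ) δ, deriv (fun R => (v R).1) R = U R := fun R hR => (hcomp R hR).1
  refine ⟨hu, hc, hu', fun R hR => ⟨?_, (hcomp R hR).2⟩⟩
  refine descend_row ha₁₁ ha₁₂ hb₁ hδ hU hu hc hu' (fun y hy => ?_) h0 R hR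
  rw [hrowU y hy, hA₁₂, (hcomp y hy).2]
  simp only [map_add]
  ring

/-! ## The resonant branch, by induction on the exponent -/

/-- **Registered helper `res_branch_nat`: THE SMOOTH BRANCH OF A FIRST-KIND SINGULAR SYSTEM WITH A VECTOR-VALUED
REGULAR ROW AT A JET RESONANCE `a₁₁(0) = n ∈ ℕ`.** See the module docstring. [folklore] -/
theorem res_branch_nat : ∀ (n : ℕ) (E : Type) [NormedAddCommGroup E] [NormedSpace ℂ E] [CompleteSpace E] (a₁₁ : ℝ → ℂ) (a₁₂ : ℝ → E →L[ℂ] ℂ) (a₂₁ : ℝ → ℂ →L[ℂ] E) (a₂₂ : ℝ → E →L[ℂ] E), ContDiff ℝ ∞ a₁₁ → ContDiff ℝ ∞ a₁₂ → ContDiff ℝ ∞ a₂₁ → ContDiff ℝ ∞ a₂₂ → a₁₁ 0 = (n : ℂ) → ∃ δ : ℝ, 0 < δ ∧ ∃ ℓ : E →L[ℂ] ℂ, ∀ (b₁ : ℝ → ℂ) (b₂ : ℝ → E), ContDiff ℝ ∞ b₁ → ContDiff ℝ ∞ b₂ → ∃ β : ℂ, ((∀ R, b₁ R = 0) → (∀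 R, b₂ R = 0) → β = 0) ∧ ∀ (c₀ : E) (t : ℂ), ℓ c₀ + β = 0 → ∃ (u : ℝ → ℂ) (c : ℝ → E), ContDiffOn ℝ ∞ u (Set.Ioo (-δ) δ) ∧ ContDiffOn ℝ ∞ c (Set.Ioo (-δ) δ) ∧ c 0 = c₀ ∧ iteratedDeriv n u 0 = t ∧ ∀ R ∈ Set.Ioo (-δ) δ, (R : ℂ) * deriv u R = a₁₁ R * u R + a₁₂ R (c R) + b₁ R ∧ deriv c R = a₂₁ R (u R) + a₂₂ R (c R) + b₂ R := by
  intro n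
  induction n with
  | zero =>
    intro E _ _ _ a₁₁ a₁₂ a₂₁ a₂₂ ha₁₁ ha₁₂ ha₂₁ ha₂₂ h0
    obtain ⟨A₁₂, A₂₂, hA₁₂s, hA₂₂s, hA₁₂, hA₂₂⟩ := derived_coefficients ha₁₁ ha₁₂ ha₂₁ ha₂₂
    -- the derived system has exponent `−1`
    obtain ⟨δ, hδ, hsolve⟩ := res_fuchs_branch (ℂ × E) (-1) (fun R => a₁₁ R - 1) A₁₂
      (fun _ => ContinuousLinearMap.inl ℂ ℂ E) A₂₂ (by simp) (ha₁₁.sub contDiff_const) hA₁₂s contDiff_const hA₂₂s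
      (by simp [h0])
    refine ⟨δ, hδ, a₁₂ 0, fun b₁ b₂ hb₁ hb₂ => ⟨b₁ 0, fun h1 _ => h1 0, fun c₀ t hct => ?_⟩⟩
    have hb₁' : ContDiff ℝ ∞ (deriv b₁) := (contDiff_infty_iff_deriv.1 hb₁).2
    obtain ⟨U, v, hU, hv, hv0, hrows⟩ := hsolve (fun R => a₁₂ R (b₂ R) + deriv b₁ R) (fun R => ((0 : ℂ), b₂ R))
      ((contDiff_clm_apply_real ha₁₂ hb₂).add hb₁') (contDiff_const.prodMk hb₂) (t, c₀)
    have hc0 : a₁₁ 0 * (v 0).1 + a₁₂ 0 (v 0).2 + b₁ 0 = 0 := by rw [hv0, h0]; simpa using hct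
    obtain ⟨hu, hc, -, hsol⟩ := lift_solution ha₁₁ ha₁₂ hb₁ hδ hA₁₂ hA₂₂ hU hv (fun R hR => (hrows R hR).1)
      (fun R hR => (hrows R hR).2) hc0
    exact ⟨fun R => (v R).1, fun R => (v R).2, hu, hc, by simp only [hv0], by rw [iteratedDeriv_zero, hv0], hsol⟩
  | succ n ih =>
    intro E _ _ _ a₁₁ a₁₂ a₂₁ a₂₂ ha₁₁ ha₁₂ ha₂₁ ha₂₂ h0
    obtain ⟨A₁₂, A₂₂, hA₁₂s, hA₂₂s, hA₁₂, hA₂₂⟩ := derived_coefficients ha₁₁ ha₁₂ ha₂₁ ha₂₂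
    -- the derived system has exponent `n`: induction
    obtain ⟨δ, hδ, ℓ', hIH⟩ := ih (ℂ × E) (fun R => a₁₁ R - 1) A₁₂ (fun _ => ContinuousLinearMap.inl ℂ ℂ E) A₂₂
      (ha₁₁.sub contDiff_const) hA₁₂s contDiff_const hA₂₂s (by simp only [h0]; push_cast; ring)
    have hN : ((n : ℂ) + 1) ≠ 0 := Nat.cast_add_one_ne_zero n
    -- the data map `c₀ ↦ (u₀, c₀)` solving the constraint of level `n + 1`
    set L : E →L[ℂ] ℂ × E := ((-((n : ℂ) + 1)⁻¹) • a₁₂ 0).prod (ContinuousLinearMap.id ℂ E) with hL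
    refine ⟨δ, hδ, ℓ'.comp L, fun b₁ b₂ hb₁ hb₂ => ?_⟩
    have hb₁' : ContDiff ℝ ∞ (deriv b₁) := (contDiff_infty_iff_deriv.1 hb₁).2
    obtain ⟨β', hflag', hsol'⟩ := hIH (fun R => a₁₂ R (b₂ R) + deriv b₁ R) (fun R => ((0 : ℂ), b₂ R))
      ((contDiff_clm_apply_real ha₁₂ hb₂).add hb₁') (contDiff_const.prodMk hb₂)
    refine ⟨β' + ℓ' ((-((n : ℂ) + 1)⁻¹ * b₁ 0), (0 : E)), fun h1 h2 => ?_, fun c₀ t hct => ?_⟩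
    · -- zero sources give `β = 0`
      have e1 : b₁ = fun _ => 0 := funext h1
      have hβ' : β' = 0 := hflag' (fun R => by simp [h2 R, e1]) (fun R => by simp [h2 R])
      rw [hβ', h1 0, mul_zero, zero_add]
      exact (ℓ'.map_zero).symm ▸ rfl
    · -- the datum of the derived system
      set u₀ : ℂ := -((n : ℂ) + 1)⁻¹ * (a₁₂ 0 c₀ + b₁ 0) with hu₀
      have hdat : ((u₀, c₀) : ℂ × E) = L c₀ + ((-((n : ℂ) + 1)⁻¹ * b₁ 0), (0 : E)) := by
        ext
        · simp [hL, hu₀]; ring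
        · simp [hL]
      have hcon : ℓ' (u₀, c₀) + β' = 0 := by
        rw [hdat, map_add]
        rw [show (ℓ'.comp L) c₀ = ℓ' (L c₀) from rfl] at hct
        linear_combination hct
      obtain ⟨U, v, hU, hv, hv0, hUt, hrows⟩ := hsol' (u₀, c₀) t hcon
      have hc0 : a₁₁ 0 * (v 0).1 + a₁₂ 0 (v 0).2 + b₁ 0 = 0 := by
        rw [hv0, h0]
        simp only [hu₀]
        push_cast
        field_simp
        ring
      obtain ⟨hu, hc, hu', hsol⟩ := lift_solution ha₁₁ ha₁₂ hb₁ hδ hA₁₂ hA₂₂ hU hv (fun R hR => (hrows R hR).1)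
        (fun R hR => (hrows R hR).2) hc0
      refine ⟨fun R => (v R).1, fun R => (v R).2, hu, hc, by simp only [hv0], ?_, hsol⟩
      -- the resonant coefficient: `u⁽ⁿ⁺¹⁾(0) = U⁽ⁿ⁾(0) = t`
      have hev : deriv (fun R => (v R).1) =ᶠ[𝓝 0] U := by
        filter_upwards [isOpen_Ioo.mem_nhds (show (0 : ℝ) ∈ Ioo (-δ) δ from ⟨by linarith, hδ⟩)] with R hR
        exact hu' R hR
      rw [iteratedDeriv_succ', Filter.EventuallyEq.iteratedDeriv_eq n hev, hUt]

/-! ## The scalar form -/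

/-- **Registered helper `fuchs_branch_resonant`: THE SMOOTH BRANCH OF THE SCALAR FIRST-KIND SINGULAR `2 × 2` SYSTEM
`R u′ = a₁₁ u + a₁₂ c + b₁`, `c′ = a₂₁ u + a₂₂ c + b₂` AT A JET RESONANCE `a₁₁(0) = m ∈ ℕ`.** There are `δ > 0` and a
COMPATIBILITY COEFFICIENT `ℓ ∈ ℂ` such that for all smooth sources there is `β ∈ ℂ` (`= 0` for zero sources) with: for
all `c₀, t` with `ℓ c₀ + β = 0` there is a `C^∞` solution on `(−δ, δ)` with `c(0) = c₀` and `u⁽ᵐ⁾(0) = t`. [folklore] -/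
theorem fuchs_branch_resonant : ∀ (m : ℕ) (a₁₁ a₁₂ a₂₁ a₂₂ : ℝ → ℂ), ContDiff ℝ ∞ a₁₁ → ContDiff ℝ ∞ a₁₂ → ContDiff ℝ ∞ a₂₁ → ContDiff ℝ ∞ a₂₂ → a₁₁ 0 = (m : ℂ) → ∃ δ : ℝ, 0 < δ ∧ ∃ ℓ : ℂ, ∀ (b₁ b₂ : ℝ → ℂ), ContDiff ℝ ∞ b₁ → ContDiff ℝ ∞ b₂ → ∃ β : ℂ, ((∀ R, b₁ R = 0) → (∀ R, b₂ R = 0) → β = 0) ∧ ∀ c₀ t : ℂ, ℓ * c₀ + β = 0 → ∃ u c : ℝ → ℂ, ContDiffOn ℝ ∞ u (Set.Ioo (-δ) δ) ∧ ContDiffOn ℝ ∞ c (Set.Ioo (-δ) δ) ∧ c 0 = c₀ ∧ iteratedDeriv m u 0 = t ∧ ∀ R ∈ Set.Ioo (-δ) δ, (R : ℂ) * deriv u R = a₁₁ R * u R + a₁₂ R * c R + b₁ R ∧ deriv c R = a₂₁ R * u R + a₂₂ R * c R + b₂ R := by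
  intro m a₁₁ a₁₂ a₂₁ a₂₂ ha₁₁ ha₁₂ ha₂₁ ha₂₂ h0
  have hsm : ∀ {a : ℝ → ℂ}, ContDiff ℝ ∞ a → ContDiff ℝ ∞ (fun R => a R • ContinuousLinearMap.id ℂ ℂ) :=
    fun ha => ha.smul contDiff_const
  obtain ⟨δ, hδ, ℓ, hmain⟩ := res_branch_nat m ℂ a₁₁ (fun R => a₁₂ R • ContinuousLinearMap.id ℂ ℂ)
    (fun R => a₂₁ R • ContinuousLinearMap.id ℂ ℂ) (fun R => a₂₂ R • ContinuousLinearMap.id ℂ ℂ) ha₁₁ (hsm ha₁₂)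
    (hsm ha₂₁) (hsm ha₂₂) h0
  refine ⟨δ, hδ, ℓ 1, fun b₁ b₂ hb₁ hb₂ => ?_⟩
  obtain ⟨β, hflag, hsol⟩ := hmain b₁ b₂ hb₁ hb₂
  refine ⟨β, hflag, fun c₀ t hct => ?_⟩
  have hℓ : ℓ c₀ = ℓ 1 * c₀ := by rw [mul_comm]; simpa using ℓ.map_smul c₀ 1
  obtain ⟨u, c, hu, hc, hc0, hut, hrows⟩ := hsol c₀ t (by rw [hℓ]; exact hct)
  refine ⟨u, c, hu, hc, hc0, hut, fun R hR => ?_⟩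
  obtain ⟨e1, e2⟩ := hrows R hR
  simp only [FunLike.coe_smul, Pi.smul_apply, ContinuousLinearMap.id_apply, smul_eq_mul] at e1 e2
  exact ⟨e1, e2⟩

end Summit.AtomisticToContinuum.HydrodynamicLimit.Theorems.SonicCavityRenewal

end
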